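import Literature.NumberTheory.EllipticCurves.Castella2018.ErratumThm23UpperDivisibilitySelfDualIrrK
import HarnessLib

/-!
# Route `ErratumRoadFive` (rung K2), ram-free IMC road: irreducibility over `K` (print's hypothesis (i) of the erratum's Thm. 2.3,
# F4♯‡) implies irreducibility over `ℚ` (the tree's `SkinnerUrban2014.IsResiduallyIrreducible`, consumed by the (glob)† lemma of the
# descent) — the 10-line order-embedding step named in `RAMFREE-REKEY-PROPOSAL.md` §1 (cell `bsd-stepL`, seat `bsd-stepL-imc-p1` g26;
# `--supports stmt-BirchSwinnertonDyer-23253`)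

* `isSimpleOrder_subrepresentation_of_comp` — for a representation `ρ` of `G` on `W` and a monoid map `f : H → G`: if `ρ ∘ f` has exactly
  two subrepresentations then so has `ρ` (a `G`-stable submodule is `H`-stable; `⊥`, `⊤` correspond). Pure algebra.
* `isResiduallyIrreducible_of_irrK` — for an ordinary newform datum `Δ` and a number field `K`: hypothesis (i) of F4♯‡
  (`IsSimpleOrder (Subrepresentation ((residualRep Δ).comp (absGaloisRestrict ℚ K)))`, «`ρ̄_g|_{G_K}` irreducible») implies
  `SkinnerUrban2014.IsResiduallyIrreducible Δ` («`ρ̄_g` irreducible»), which is what the landed descent ∕ (glob)† lemmas of line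
  `erratum_chain`† consume (`SelfDualTwist.noFixedTorsion_selfDual_of_isResiduallyIrreducible'`, `IrrK.noFixedTorsion_of_isResiduallyIrreducible`).

HONEST FRAMING: elementary; THEOREMS ONLY; nothing about L-functions; no item closes; BSD is proved for no pair; closes: none (T7).
[cite: Castella2018Erratum, Thm. 2.3 (i) (p. 3) and footnote 1 (p. 4) (the two hypotheses related here; nothing else asserted)]
-/

set_option autoImplicit false
-- the cell's Theorems namespace repeats the summit name (Summit.<Summit>.<Problem>), as in every sibling file
set_option linter.dupNamespace false

namespace Summit.BirchSwinnertonDyer.BirchSwinnertonDyer.Theorems.RamFree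

/-- **Irreducible after restriction ⟹ irreducible.** For a representation `ρ : G →* End_A(W)` and a monoid homomorphism `f : H →* G`,
if the restricted representation `ρ ∘ f` of `H` has exactly two subrepresentations (`⊥` and `⊤`), then so has `ρ`: every `G`-stable
submodule is `H`-stable, and the comparison map preserves `⊥` and `⊤`. [folklore] -/
theorem isSimpleOrder_subrepresentation_of_comp {A G H W : Type*} [CommSemiring A] [Monoid G] [Monoid H]
    [AddCommMonoid W] [Module A W] (ρ : Representation A G W) (f : H →* G)
    (h : IsSimpleOrder (Subrepresentation (ρ.comp f))) : IsSimpleOrder (Subrepresentation ρ) := by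
  haveI := h
  -- the comparison map: a `G`-stable submodule is `H`-stable through `f`
  let res : Subrepresentation ρ → Subrepresentation (ρ.comp f) := fun σ =>
    ⟨σ.toSubmodule, fun x v hv => σ.apply_mem_toSubmodule (f x) hv⟩
  have hbot : (⊥ : Subrepresentation (ρ.comp f)).toSubmodule = (⊥ : Subrepresentation ρ).toSubmodule := rfl
  have htop : (⊤ : Subrepresentation (ρ.comp f)).toSubmodule = (⊤ : Subrepresentation ρ).toSubmodule := rfl
  haveI : Nontrivial (Subrepresentation ρ) := ⟨⟨⊥, ⊤, fun hbt => by
    have hne : (⊥ : Subrepresentation (ρ.comp f)) ≠ ⊤ := bot_ne_top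
    exact hne (Subrepresentation.toSubmodule_injective
      (hbot.trans ((congrArg Subrepresentation.toSubmodule hbt).trans htop.symm)))⟩⟩
  refine { eq_bot_or_eq_top := fun σ => ?_ }
  rcases IsSimpleOrder.eq_bot_or_eq_top (res σ) with hσ | hσ
  · left
    have e : σ.toSubmodule = (⊥ : Subrepresentation (ρ.comp f)).toSubmodule :=
      congrArg Subrepresentation.toSubmodule hσ
    exact Subrepresentation.toSubmodule_injective (e.trans hbot)
  · right
    have e : σ.toSubmodule = (⊤ : Subrepresentation (ρ.comp f)).toSubmodule :=
      congrArg Subrepresentation.toSubmodule hσ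
    exact Subrepresentation.toSubmodule_injective (e.trans htop)

open Field Literature.NumberTheory.EllipticCurves Literature.NumberTheory.EllipticCurves.ModularForms
  Literature.NumberTheory.EllipticCurves.GreenbergSelmer Literature.NumberTheory.GaloisRepresentations in
/-- **Hypothesis (i) of F4♯‡ implies hypothesis (irred) of F4♯†**: for an ordinary newform datum `Δ` and a number field `K`, if the
reduction `ρ̄ = ρ mod ϖ` restricted along `absGaloisRestrict ℚ K` is irreducible («`ρ̄_g|_{G_K}` irreducible», erratum Thm. 2.3 (i) as
printed), then `ρ̄` is irreducible («`ρ̄_g` irreducible», `SkinnerUrban2014.IsResiduallyIrreducible Δ`) — the input of the (glob)† lemmas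
of line `erratum_chain`†. [cite: Castella2018Erratum, Thm. 2.3 (i) (p. 3)] -/
theorem isResiduallyIrreducible_of_irrK {M : ℕ} {k : ℤ} {g : CuspForm (CongruenceSubgroup.Gamma0 M) k} {p : ℕ}
    [Fact p.Prime] {ι : coeffField g →+* PadicAlgCl p} (Δ : OrdinaryNewformDatum g p ι)
    (K : Type) [Field K] [NumberField K]
    (h : IsSimpleOrder (Subrepresentation
      ((SkinnerUrban2014.residualRep Δ).comp (absGaloisRestrict ℚ K : absoluteGaloisGroup K →* absoluteGaloisGroup ℚ)))) :
    SkinnerUrban2014.IsResiduallyIrreducible Δ :=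
  isSimpleOrder_subrepresentation_of_comp _ _ h

end Summit.BirchSwinnertonDyer.BirchSwinnertonDyer.Theorems.RamFree
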